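import Mathlib
import Summits.Ventures.PercRepro2.CoinOrTailAlg
import Summits.Ventures.PercRepro2.CoinBlockTheoremII
import Summits.Ventures.PercRepro2.CoinBlockMeanOrder
import Summits.Ventures.PercRepro2.CoinLsmCoreSure
import Summits.Ventures.PercRepro2.CoinMixBlock
import Summits.Ventures.PercRepro2.CoinOrTailKDefs
import Summits.Ventures.PercRepro2.CoinOrTailKSums
import Summits.Ventures.PercRepro2.CoinOrTailKCore
import Summits.Ventures.PercRepro2.CoinK2HeadBlindBlock

/-!
# Two incomparable uncovered entries, head-blind: the cluster-level vocabulary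
(blind cell PercRepro2, night-2 g12; proofs/NIGHT2-DARC.md §47)

The sure-coin values of `rValK` / `gValK` (`tailWtK_sure`, `rValK_sure_of_entry`,
`gValK_sure_of_entry`), the entry traces of the four entry states (`inter_ent_*`), the filter
indicator as a sum of two cell weights (`mWt_true_eq_cell_sum`), and the two PIECE LEMMAS
`gateF_nonneg_of_above` / `gateF_nonneg_of_below`: a log-supermodular weight that is Holley-above
(resp. below) the `R`-weight has a nonnegative gate functional at block level — `cellBlock_mul_le`
for the block log-supermodularity and the Holley relations, `holleyBlock_D_nonneg` for the two
marker-mean orderings, `blockMean_nonneg` / `blockBelow_nonneg` to close.  These are the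
principal-filter and principal-ideal restrictions of Lemma «filter ⊔ ideal» of §47.
-/

namespace Summit.Ventures.PercRepro2.Coin

open Classical

section K2Vals

variable {V : Type*} {E : Type*} [DecidableEq V] {R : Type*} [Field R]

/-- With sure entry coins the tail weight is the indicator «no entry of `W`». -/
lemma tailWtK_sure (pr : E → R) {ent : Finset V} (c : V → E) (hsure : ∀ r ∈ ent, pr (c r) = 1)
    (W : Finset V) :
    tailWtK pr ent c W = if ∃ r ∈ ent, r ∈ W then 0 else 1 := by
  unfold tailWtK
  split_ifs with h
  · obtain ⟨r, hr, hrW⟩ := h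
    exact Finset.prod_eq_zero hr (by simp [hsure r hr, hrW])
  · exact Finset.prod_eq_one fun r hr => by
      have : r ∉ W := fun hrW => h ⟨r, hr, hrW⟩
      simp [this]

/-- The `R`-value of a cluster with an entry, sure coins: the head value with `a` added. -/
lemma rValK_sure_of_entry (A : Finset V → R) (pr : E → R) {ent : Finset V} (c : V → E) (a : V)
    (hsure : ∀ r ∈ ent, pr (c r) = 1) {W : Finset V} (h : ∃ r ∈ ent, r ∈ W) :
    rValK A pr ent c a W = A (W ∪ {a}) := by
  unfold rValK
  rw [tailWtK_sure pr c hsure, if_pos h]; ring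

/-- The gate value of a cluster with an entry, sure coins: the head value with `a, w` added. -/
lemma gValK_sure_of_entry (A : Finset V → R) (pr : E → R) {ent : Finset V} (c : V → E) (a w : V)
    (hsure : ∀ r ∈ ent, pr (c r) = 1) {W : Finset V} (h : ∃ r ∈ ent, r ∈ W) :
    gValK A pr ent c a w W = A (W ∪ {a, w}) := by
  unfold gValK
  rw [tailWtK_sure pr c hsure, if_pos h]; ring

/-- The `R`-value of an entry-free cluster is the bare head value. -/
lemma rValK_of_no_entry (A : Finset V → R) (pr : E → R) {ent : Finset V} (c : V → E) (a : V)
    {W : Finset V} (h : ∀ r ∈ ent, r ∉ W) : rValK A pr ent c a W = A W := by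
  unfold rValK
  rw [tailWtK_eq_one_of_no_entry pr c h]; ring

/-- The entry trace of a cluster of the state `(false, false)`. -/
lemma inter_ent_ff {ent : Finset V} {r₁ r₂ : V} (hent : ∀ r ∈ ent, r = r₁ ∨ r = r₂) {W : Finset V}
    (h₁ : r₁ ∉ W) (h₂ : r₂ ∉ W) : W ∩ ent = ∅ := by
  ext x
  simp only [Finset.mem_inter, Finset.notMem_empty, iff_false]
  rintro ⟨hxW, hx⟩
  rcases hent x hx with rfl | rfl
  · exact h₁ hxW
  · exact h₂ hxW

/-- The entry trace of a cluster of the state `(true, false)`. -/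
lemma inter_ent_tf {ent : Finset V} {r₁ r₂ : V} (hent : ∀ r ∈ ent, r = r₁ ∨ r = r₂)
    (hr₁ : r₁ ∈ ent) {W : Finset V} (h₁ : r₁ ∈ W) (h₂ : r₂ ∉ W) : W ∩ ent = {r₁} := by
  ext x
  simp only [Finset.mem_inter, Finset.mem_singleton]
  constructor
  · rintro ⟨hxW, hx⟩
    rcases hent x hx with rfl | rfl
    · rfl
    · exact absurd hxW h₂
  · rintro rfl; exact ⟨h₁, hr₁⟩

/-- The entry trace of a cluster of the state `(false, true)`. -/
lemma inter_ent_ft {ent : Finset V} {r₁ r₂ : V} (hent : ∀ r ∈ ent, r = r₁ ∨ r = r₂)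
    (hr₂ : r₂ ∈ ent) {W : Finset V} (h₁ : r₁ ∉ W) (h₂ : r₂ ∈ W) : W ∩ ent = {r₂} := by
  ext x
  simp only [Finset.mem_inter, Finset.mem_singleton]
  constructor
  · rintro ⟨hxW, hx⟩
    rcases hent x hx with rfl | rfl
    · exact absurd hxW h₁
    · rfl
  · rintro rfl; exact ⟨h₂, hr₂⟩

/-- The entry trace of a cluster of the state `(true, true)`. -/
lemma inter_ent_tt {ent : Finset V} {r₁ r₂ : V} (hent : ∀ r ∈ ent, r = r₁ ∨ r = r₂) {W : Finset V}
    (h₁ : r₁ ∈ W) (h₂ : r₂ ∈ W) : W ∩ ent = ent := by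
  ext x
  simp only [Finset.mem_inter, and_iff_right_iff_imp]
  intro hx
  rcases hent x hx with rfl | rfl
  · exact h₁
  · exact h₂

end K2Vals

section K2Pieces

variable {V : Type*} [DecidableEq V] {R : Type*} [Field R] [LinearOrder R] [IsStrictOrderedRing R]

/-- **A log-supermodular weight Holley-ABOVE the `R`-weight has a nonnegative gate functional**:
the block sums of `F` against those of `G` (`F s·G t ≤ G (s ∩ t)·F (s ∪ t)` pointwise, both
log-supermodular), by `cellBlock_mul_le` + `holleyBlock_D_nonneg` + `blockMean_nonneg`. -/
theorem gateF_nonneg_of_above (U : Finset V) (G F : Finset V → R) (m₁ m₂ : V)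
    (hG0 : ∀ W, 0 ≤ G W) (hF0 : ∀ W, 0 ≤ F W)
    (hG : ∀ s ⊆ U, ∀ t ⊆ U, G s * G t ≤ G (s ∩ t) * G (s ∪ t))
    (hF : ∀ s ⊆ U, ∀ t ⊆ U, F s * F t ≤ F (s ∩ t) * F (s ∪ t))
    (hFG : ∀ s ⊆ U, ∀ t ⊆ U, F s * G t ≤ G (s ∩ t) * F (s ∪ t)) :
    0 ≤ gateF (∑ W ∈ U.powerset, G W * cellWt m₁ m₂ false false W)
      (∑ W ∈ U.powerset, G W * cellWt m₁ m₂ false true W)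
      (∑ W ∈ U.powerset, G W * cellWt m₁ m₂ true false W)
      (∑ W ∈ U.powerset, G W * cellWt m₁ m₂ true true W)
      (∑ W ∈ U.powerset, F W * cellWt m₁ m₂ false false W)
      (∑ W ∈ U.powerset, F W * cellWt m₁ m₂ false true W)
      (∑ W ∈ U.powerset, F W * cellWt m₁ m₂ true false W)
      (∑ W ∈ U.powerset, F W * cellWt m₁ m₂ true true W) := by
  set L : Bool → Bool → R := fun b₁ b₂ => ∑ W ∈ U.powerset, G W * cellWt m₁ m₂ b₁ b₂ W with hLdef
  set M : Bool → Bool → R := fun b₁ b₂ => ∑ W ∈ U.powerset, F W * cellWt m₁ m₂ b₁ b₂ W with hMdef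
  have hL0 : ∀ b₁ b₂, 0 ≤ L b₁ b₂ := fun b₁ b₂ =>
    Finset.sum_nonneg fun W _ => mul_nonneg (hG0 W) (cellWt_nonneg _ _ _ _ _)
  have hM0 : ∀ b₁ b₂, 0 ≤ M b₁ b₂ := fun b₁ b₂ =>
    Finset.sum_nonneg fun W _ => mul_nonneg (hF0 W) (cellWt_nonneg _ _ _ _ _)
  have H1 : L true false * L false true ≤ L false false * L true true := by
    have := cellBlock_mul_le U G G G G m₁ m₂ true false false true hG0 hG0 hG0 hG0 hG
    simpa only [Bool.true_and, Bool.and_true, Bool.false_or, Bool.or_false] using this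
  have H2 : M true false * M false true ≤ M false false * M true true := by
    have := cellBlock_mul_le U F F F F m₁ m₂ true false false true hF0 hF0 hF0 hF0 hF
    simpa only [Bool.true_and, Bool.and_true, Bool.false_or, Bool.or_false] using this
  -- the Holley relations `M ≽ L` at block level
  have hol : ∀ b₁ b₂ b₁' b₂', M b₁ b₂ * L b₁' b₂' ≤ L (b₁ && b₁') (b₂ && b₂') * M (b₁ || b₁') (b₂ || b₂') :=
    fun b₁ b₂ b₁' b₂' => cellBlock_mul_le U F G G F m₁ m₂ b₁ b₂ b₁' b₂' hF0 hG0 hG0 hF0 hFG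
  have G1 := hol false false true false
  have G4 := hol false true true true
  have G5 := hol false false true true
  have G6 := hol false true true false
  have G1' := hol false false false true
  have G4' := hol true false true true
  have G6' := hol true false false true
  simp only [Bool.and_self, Bool.or_self, Bool.and_false, Bool.and_true, Bool.or_false,
    Bool.or_true] at G1 G4 G5 G6 G1' G4' G6'
  have hD1 := holleyBlock_D_nonneg (L false false) (L false true) (L true false) (L true true)
    (M false false) (M false true) (M true false) (M true true) (hL0 _ _) (hL0 _ _) (hL0 _ _)
    (hL0 _ _) (hM0 _ _) H1 G1 G4 G5 G6
  have hD2 := holleyBlock_D_nonneg (L false false) (L true false) (L false true) (L true true)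
    (M false false) (M true false) (M false true) (M true true) (hL0 _ _) (hL0 _ _) (hL0 _ _)
    (hL0 _ _) (hM0 _ _) (by linarith) G1' G4' G5 G6'
  unfold gateF
  exact blockMean_nonneg (L false false) (L false true) (L true false) (L true true)
    (M false false) (M false true) (M true false) (M true true) (hM0 _ _) (hM0 _ _) (hM0 _ _)
    (hM0 _ _) H2 (by linarith) (by linarith)

/-- **A log-supermodular weight Holley-BELOW the `R`-weight has a nonnegative gate functional**
(`G s·F t ≤ F (s ∩ t)·G (s ∪ t)` pointwise): both marker shifts are `≤ 0`, `blockBelow_nonneg`. -/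
theorem gateF_nonneg_of_below (U : Finset V) (G F : Finset V → R) (m₁ m₂ : V)
    (hG0 : ∀ W, 0 ≤ G W) (hF0 : ∀ W, 0 ≤ F W)
    (hF : ∀ s ⊆ U, ∀ t ⊆ U, F s * F t ≤ F (s ∩ t) * F (s ∪ t))
    (hGF : ∀ s ⊆ U, ∀ t ⊆ U, G s * F t ≤ F (s ∩ t) * G (s ∪ t)) :
    0 ≤ gateF (∑ W ∈ U.powerset, G W * cellWt m₁ m₂ false false W)
      (∑ W ∈ U.powerset, G W * cellWt m₁ m₂ false true W)
      (∑ W ∈ U.powerset, G W * cellWt m₁ m₂ true false W)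
      (∑ W ∈ U.powerset, G W * cellWt m₁ m₂ true true W)
      (∑ W ∈ U.powerset, F W * cellWt m₁ m₂ false false W)
      (∑ W ∈ U.powerset, F W * cellWt m₁ m₂ false true W)
      (∑ W ∈ U.powerset, F W * cellWt m₁ m₂ true false W)
      (∑ W ∈ U.powerset, F W * cellWt m₁ m₂ true true W) := by
  set L : Bool → Bool → R := fun b₁ b₂ => ∑ W ∈ U.powerset, G W * cellWt m₁ m₂ b₁ b₂ W with hLdef
  set M : Bool → Bool → R := fun b₁ b₂ => ∑ W ∈ U.powerset, F W * cellWt m₁ m₂ b₁ b₂ W with hMdef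
  have hL0 : ∀ b₁ b₂, 0 ≤ L b₁ b₂ := fun b₁ b₂ =>
    Finset.sum_nonneg fun W _ => mul_nonneg (hG0 W) (cellWt_nonneg _ _ _ _ _)
  have hM0 : ∀ b₁ b₂, 0 ≤ M b₁ b₂ := fun b₁ b₂ =>
    Finset.sum_nonneg fun W _ => mul_nonneg (hF0 W) (cellWt_nonneg _ _ _ _ _)
  have H2 : M true false * M false true ≤ M false false * M true true := by
    have := cellBlock_mul_le U F F F F m₁ m₂ true false false true hF0 hF0 hF0 hF0 hF
    simpa only [Bool.true_and, Bool.and_true, Bool.false_or, Bool.or_false] using this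
  -- the Holley relations `L ≽ M` at block level
  have hol : ∀ b₁ b₂ b₁' b₂', L b₁ b₂ * M b₁' b₂' ≤ M (b₁ && b₁') (b₂ && b₂') * L (b₁ || b₁') (b₂ || b₂') :=
    fun b₁ b₂ b₁' b₂' => cellBlock_mul_le U G F F G m₁ m₂ b₁ b₂ b₁' b₂' hG0 hF0 hF0 hG0 hGF
  have G1 := hol false false true false
  have G4 := hol false true true true
  have G5 := hol false false true true
  have G6 := hol false true true false
  have G1' := hol false false false true
  have G4' := hol true false true true
  have G6' := hol true false false true
  simp only [Bool.and_self, Bool.or_self, Bool.and_false, Bool.and_true, Bool.or_false,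
    Bool.or_true] at G1 G4 G5 G6 G1' G4' G6'
  -- `holleyBlock_D_nonneg` with the roles exchanged: the shifts of `M` against `L` are `≤ 0`
  have hD1 := holleyBlock_D_nonneg (M false false) (M false true) (M true false) (M true true)
    (L false false) (L false true) (L true false) (L true true) (hM0 _ _) (hM0 _ _) (hM0 _ _)
    (hM0 _ _) (hL0 _ _) H2 G1 G4 G5 G6
  have hD2 := holleyBlock_D_nonneg (M false false) (M true false) (M false true) (M true true)
    (L false false) (L true false) (L false true) (L true true) (hM0 _ _) (hM0 _ _) (hM0 _ _)
    (hM0 _ _) (hL0 _ _) (by linarith) G1' G4' G5 G6'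
  unfold gateF
  exact blockBelow_nonneg (L false false) (L false true) (L true false) (L true true)
    (M false false) (M false true) (M true false) (M true true) (hM0 _ _) (hM0 _ _) (hM0 _ _)
    (hM0 _ _) H2 (by linarith) (by linarith)

omit [LinearOrder R] [IsStrictOrderedRing R] in
/-- The filter indicator of `r₁` is the sum of the two cell weights with `r₁` present. -/
lemma mWt_true_eq_cell_sum (r₁ r₂ : V) (W : Finset V) :
    mWt (R := R) r₁ true W = cellWt r₁ r₂ true false W + cellWt r₁ r₂ true true W := by
  unfold cellWt mWt
  by_cases h₁ : r₁ ∈ W <;> by_cases h₂ : r₂ ∈ W <;> simp [h₁, h₂]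

omit [LinearOrder R] [IsStrictOrderedRing R] in
/-- The filter indicator of `r₂` is the sum of the two cell weights with `r₂` present. -/
lemma mWt_true_eq_cell_sum' (r₁ r₂ : V) (W : Finset V) :
    mWt (R := R) r₂ true W = cellWt r₁ r₂ false true W + cellWt r₁ r₂ true true W := by
  unfold cellWt mWt
  by_cases h₁ : r₁ ∈ W <;> by_cases h₂ : r₂ ∈ W <;> simp [h₁, h₂]

end K2Pieces

end Summit.Ventures.PercRepro2.Coin
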